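import Summits.Ventures.CertifiedManyBodySolver.Theorems.M3x2EdgeSplitSymReplayOutRoutePF
import HarnessLib

/-!
# SymReplay — lever (β) INTEGER-ROW DOTS (pen spec hub-lb-sym-plan-1 g4, EBUDGET-600 §10; crit-1 V172: «β first»)

The per-hit Gram dot `sdot L_i L_j` (sparse ascending rows over `ℚ`, ≈ 32 µs per hit at E₁ row length ≈ 40, 19 % of the
per-product bill r₀, §9g) is replaced by an INTEGER dot on rows shipped / decoded as `ℤ` numerators over ONE denominator `D`
per block: a row of record is `liftRow D rz = rz.map (z, k) ↦ (z / D, k)`, and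

  `sdot (liftRow D rz) (liftRow D rz') = sdotZ rz rz' / (D * D)`            (`sdot_liftRow`, PROVED here)

so the enumerator twin reads `g := sdotZ rz rz'` (one `Int.mul` + `Int.add` per matched column, no `Rat` normalisation) and
emits the coefficient `−m · s · (g / D²) · c · c'` (`stepOptZ`, `stepOptZ_eq` PROVED here).  No producer mathematics changes:
either the producer ships `(D, rowsZ)` per block and the DECODER defines `rows := rowsZ.map (liftRow D)` (then every block is a
`liftRow` image by construction — zero extra facts), or the checker computes `D := lcm of denominators`, `rz := rowZ D r` at
decode time and checks `liftRow D (rowZ D r) = r` once per cert (one cheap global `decide` fact, like `hcov`).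

CONTENTS: `sdotZF`/`sdotZ` (verbatim `ℤ` twins of `sdotF`/`sdot`), `liftRow`, `rowZ`, `rowsDen`, `liftOK`;
`sdotF_liftRow` (fuel-general), `sdot_liftRow`; `stepOptZ`, `stepOptZ_eq`.
(c) the hierarchical enumerator twins `wflatZ` / `rowFastFZ` / `shareRWithMFZ` / `shareRFastMFZ` (checker-side `D`, `rowZ`),
the one global side fact `liftOKR K`, the LIST BRIDGE `shareRFastMFZ_eq : shareRFastMFZ … = shareRFastMF …` and the closing
`energyDensity_ge_of_outroutePMFZ0` (= `…PMF0` with the integer-dot share; grammar: per module `out_m : PackedNF.pisZero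
(PackedNF.pcanonNFZHBZ lo hi PackedNF.oracleV3 (PackedNF.encP lo hi (shareRFastMFZ momSpecC cert gbs tabC κ₂ J L (m / L) (m % L))))
= true := by native_decide`, plus ONE global `hZ : liftOKR cert = true := by native_decide`).

HONEST FRAMING: an executable cost lever with its equality proofs; EST gain −14–19 % on J(E₁) (§10, unbenched); certifies
nothing; no bound of record moves; no summit or crux statement is proved; nothing here predicts superconductivity.
-/

namespace Summit.Ventures.CertifiedManyBodySolver.Theorems.SymReplay

open Literature.MathematicalPhysics.QuantumLattice
open Literature.MathematicalPhysics.QuantumLattice.HubbardWave0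
open Literature.MathematicalPhysics.QuantumLattice.ThermodynamicLimit
open Literature.Probability.LatticeModels
open Literature.MathematicalPhysics.QuantumManyBody.StateRelaxation
open Summit.Ventures.CertifiedManyBodySolver.Theorems.WardSlot

/-! ##### (a) integer sparse dot and the lifting identity -/

/-- `ℤ` twin of `sdotF` (same merge, same fuel structure). -/
def sdotZF : ℕ → List (ℤ × ℕ) → List (ℤ × ℕ) → ℤ → ℤ
  | 0, _, _, acc => acc
  | _ + 1, [], _, acc => acc
  | _ + 1, _, [], acc => acc
  | n + 1, (a, i) :: r, (b, j) :: r', acc =>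
    if i < j then sdotZF n r ((b, j) :: r') acc
    else if j < i then sdotZF n ((a, i) :: r) r' acc
    else sdotZF n r r' (acc + a * b)

/-- `ℤ` twin of `sdot`. -/
def sdotZ (r r' : List (ℤ × ℕ)) : ℤ := sdotZF (r.length + r'.length) r r' 0

/-- The `ℚ` row of record denoted by an integer row over the block denominator `D`. -/
def liftRow (D : ℚ) (rz : List (ℤ × ℕ)) : List (ℚ × ℕ) := rz.map fun e => ((e.1 : ℚ) / D, e.2)

/-- Checker-side integerisation of a `ℚ` row (numerators after scaling by `D`). -/
def rowZ (D : ℕ) (r : List (ℚ × ℕ)) : List (ℤ × ℕ) := r.map fun e => ((e.1 * (D : ℚ)).num, e.2)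

/-- Checker-side choice of `D`: the lcm of all denominators of a block's rows. -/
def rowsDen (rows : List (List (ℚ × ℕ))) : ℕ :=
  rows.foldl (fun d r => r.foldl (fun d e => Nat.lcm d e.1.den) d) 1

/-- The one global side fact of the checker-side variant: every row is recovered from its integerisation. -/
def liftOK (D : ℕ) (rows : List (List (ℚ × ℕ))) : Bool :=
  rows.all fun r => decide (liftRow D (rowZ D r) = r)

/-- Fuel-general lifting identity. -/
theorem sdotF_liftRow (D : ℚ) (hD : D ≠ 0) :
    ∀ (n : ℕ) (rz rz' : List (ℤ × ℕ)) (acc : ℤ),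
      sdotF n (liftRow D rz) (liftRow D rz') ((acc : ℚ) / (D * D)) = (sdotZF n rz rz' acc : ℚ) / (D * D)
  | 0, rz, rz', acc => by simp [sdotF, sdotZF]
  | n + 1, [], rz', acc => by simp [liftRow, sdotF, sdotZF]
  | n + 1, (a, i) :: r, [], acc => by simp [liftRow, sdotF, sdotZF]
  | n + 1, (a, i) :: r, (b, j) :: r', acc => by
    have ih₁ := sdotF_liftRow D hD n r ((b, j) :: r') acc
    have ih₂ := sdotF_liftRow D hD n ((a, i) :: r) r' acc
    have ih₃ := sdotF_liftRow D hD n r r' (acc + a * b)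
    simp only [liftRow, List.map_cons] at ih₁ ih₂ ih₃ ⊢
    simp only [sdotF, sdotZF]
    split_ifs with h₁ h₂
    · exact ih₁
    · exact ih₂
    · have : (acc : ℚ) / (D * D) + (a : ℚ) / D * ((b : ℚ) / D) = ((acc + a * b : ℤ) : ℚ) / (D * D) := by
        push_cast
        field_simp
      rw [this]
      exact ih₃

/-- **Lifting identity**: the `ℚ` dot of record on lifted rows is the integer dot over `D²`. -/
theorem sdot_liftRow (D : ℚ) (hD : D ≠ 0) (rz rz' : List (ℤ × ℕ)) :
    sdot (liftRow D rz) (liftRow D rz') = (sdotZ rz rz' : ℚ) / (D * D) := by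
  unfold sdot sdotZ
  have h := sdotF_liftRow D hD (rz.length + rz'.length) rz rz' 0
  simp only [Int.cast_zero, zero_div] at h
  simpa [liftRow] using h

/-! ##### (b) the per-hit step with an integer dot -/

/-- Twin of `stepOpt` reading an INTEGER dot: `aZ` = the representative's integer row, `x.1` = the basis term's integer row,
`c = 1 / D²` precomputed once per block. -/
def stepOptZ (aZ : List (ℤ × ℕ)) (m s c : ℚ) (t : ℚ × Word) (x : List (ℤ × ℕ) × (ℚ × Word)) : Option (ℚ × Word) :=
  let g := sdotZ aZ x.1
  if g = 0 then none else some (-1 * (m * (s * ((g : ℚ) * c))) * (t.1 * x.2.1), t.2 ++ x.2.2)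

/-- **`stepOptZ` IS `stepOpt` on lifted rows.** -/
theorem stepOptZ_eq (D : ℚ) (hD : D ≠ 0) (p : QPoly) (aZ : List (ℤ × ℕ)) (m s : ℚ) (t : ℚ × Word)
    (x : List (ℤ × ℕ) × (ℚ × Word)) :
    stepOptZ aZ m s (1 / (D * D)) t x = stepOpt (p, liftRow D aZ) m s t (liftRow D x.1, x.2) := by
  obtain ⟨xz, cw⟩ := x
  unfold stepOptZ stepOpt
  simp only [sdot_liftRow D hD]
  have hDD : (D * D) ≠ 0 := mul_ne_zero hD hD
  by_cases hg : sdotZ aZ xz = 0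
  · simp [hg]
  · have hq : ((sdotZ aZ xz : ℚ)) / (D * D) ≠ 0 := div_ne_zero (by exact_mod_cast hg) hDD
    have hc : (sdotZ aZ xz : ℚ) * (1 / (D * D)) = (sdotZ aZ xz : ℚ) / (D * D) := mul_one_div _ _
    simp only [hc, if_neg hg, if_neg hq]


/-! ##### (c) hierarchical enumerator twins with integer dots, the list bridge, the closing -/

section IntRows

variable {M : Type} [DecidableEq M] [Hashable M]

/-- Tagged basis terms with INTEGER rows: `(Lz_j, (c', w))` for every term of every basis polynomial (twin of `wflat`). -/
def wflatZ (qr : List (QPoly × List (ℤ × ℕ))) : List (List (ℤ × ℕ) × (ℚ × Word)) :=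
  qr.flatMap fun b => b.1.map fun t' => (b.2, t')

/-- **One representative row, secondary test before the INTEGER dot** (twin of `rowFastF`; `c = 1 / D²`). -/
def rowFastFZ (S : MomSpec M) (a : QPoly × List (ℤ × ℕ)) (wmap : Std.HashMap M (List (List (ℤ × ℕ) × (ℚ × Word))))
    (m s c : ℚ) (T : List M) (P₂ : Word → Bool) : QPoly :=
  (padj a.1).flatMap fun t =>
    T.flatMap fun mt =>
      (wmap.getD (S.sub mt (mom S t.2)) []).filterMap fun x =>
        if P₂ (t.2 ++ x.2.2) then stepOptZ a.2 m s c t x else none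

/-- Checker-side block denominator. -/
def blockDen (B : GramBlockR) : ℕ := rowsDen B.rows

/-- Checker-side integer rows of a block. -/
def blockRowsZ (B : GramBlockR) : List (List (ℤ × ℕ)) := B.rows.map (rowZ (blockDen B))

/-- **R-part of sub-module `(i, f)` with integer dots** (twin of `shareRWithMF`). -/
def shareRWithMFZ (S : MomSpec M) (K : SymCertR) (gbs : List (List QPoly)) (T : List M) (P₂ : Word → Bool) : QPoly :=
  (K.gramR.zip gbs).flatMap fun Bg =>
    let D := blockDen Bg.1
    let rz := blockRowsZ Bg.1
    let wmap := bucketBy (fun x : List (ℤ × ℕ) × (ℚ × Word) => mom S x.2.2) (wflatZ (Bg.2.zip rz))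
    (Bg.1.reps.zip rz).flatMap fun a => rowFastFZ S a wmap Bg.1.moves.length Bg.1.scale (1 / ((D : ℚ) * D)) T P₂

/-- **Sub-module `(i, f)`'s share with integer dots** (twin of `shareRFastMF`; same list, `shareRFastMFZ_eq`). -/
def shareRFastMFZ (S : MomSpec M) (K : SymCertR) (gbs : List (List QPoly)) (hm : MomTable M) (κ₂ : Word → ℕ)
    (J L i f : ℕ) : QPoly :=
  let P := wordPred (inSlotW (momKey S hm) J i)
  let P₂ : Word → Bool := fun w => κ₂ w % L == f
  (baseShareF K.toSymCert P).filter (wordPred P₂) ++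
  ((pscale (-1) (K.gramM.flatMap fun B => (gramBlockPoly B).filter P)).filter (wordPred P₂) ++
    shareRWithMFZ S K gbs (targetsM hm J i) P₂)

/-- **The one global side fact** (checker-side variant): every R-block has `D ≠ 0` and rows recovered from their integerisation. -/
def liftOKR (K : SymCertR) : Bool :=
  K.gramR.all fun B => decide (0 < blockDen B) && liftOK (blockDen B) B.rows

/-- `wflat` of lifted rows is the lift of `wflatZ`. -/
theorem wflat_lift (D : ℚ) : ∀ (qrz : List (QPoly × List (ℤ × ℕ))),
    wflat (qrz.map fun b => (b.1, liftRow D b.2)) = (wflatZ qrz).map fun x => (liftRow D x.1, x.2)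
  | [] => rfl
  | b :: qrz => by
    have ih := wflat_lift D qrz
    simp only [wflat, wflatZ, List.map_cons, List.flatMap_cons, List.map_append, List.map_map] at ih ⊢
    rw [ih]
    rfl

/-- **Row twin = row of record on lifted data** (pattern of `rowFastC_eq`). -/
theorem rowFastFZ_eq (S : MomSpec M) (D : ℚ) (hD : D ≠ 0) (p : QPoly) (aZ : List (ℤ × ℕ))
    (qrz : List (QPoly × List (ℤ × ℕ))) (m s : ℚ) (T : List M) (P₂ : Word → Bool) :
    rowFastFZ S (p, aZ) (bucketBy (fun x : List (ℤ × ℕ) × (ℚ × Word) => mom S x.2.2) (wflatZ qrz)) m s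
        (1 / (D * D)) T P₂ =
      rowFastF S (p, liftRow D aZ) (bucketOf S (wflat (qrz.map fun b => (b.1, liftRow D b.2)))) m s T P₂ := by
  unfold rowFastFZ rowFastF
  refine List.flatMap_congr fun t _ => List.flatMap_congr fun mt _ => ?_
  rw [bucketOf_getD, bucketBy_getD, wflat_lift, List.filter_map, ← List.map_reverse, List.filterMap_map]
  have hf : ((fun x : List (ℚ × ℕ) × (ℚ × Word) => decide (mom S x.2.2 = S.sub mt (mom S t.2))) ∘
      fun x : List (ℤ × ℕ) × (ℚ × Word) => (liftRow D x.1, x.2)) =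
      fun x => decide (mom S x.2.2 = S.sub mt (mom S t.2)) := rfl
  rw [hf]
  refine List.filterMap_congr fun x _ => ?_
  rw [Function.comp_apply, stepOptZ_eq D hD p aZ m s t x]

/-- Rows of a block passing `liftOK` are the lift of their integerisation. -/
theorem rows_eq_lift (D : ℕ) : ∀ (rows : List (List (ℚ × ℕ))), liftOK D rows = true →
    rows = (rows.map (rowZ D)).map (liftRow (D : ℚ))
  | [], _ => rfl
  | r :: rows, h => by
    have h' : liftRow (D : ℚ) (rowZ D r) = r ∧ liftOK D rows = true := by
      simpa [liftOK, List.all_cons] using h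
    rw [List.map_cons, List.map_cons, h'.1]
    exact congrArg (r :: ·) (rows_eq_lift D rows h'.2)

/-- **Block twin = block of record** under the side fact. -/
theorem shareRWithMFZ_eq (S : MomSpec M) (K : SymCertR) (hZ : liftOKR K = true) (gbs : List (List QPoly)) (T : List M)
    (P₂ : Word → Bool) : shareRWithMFZ S K gbs T P₂ = shareRWithMF S K gbs T P₂ := by
  unfold shareRWithMFZ shareRWithMF
  refine List.flatMap_congr fun Bg hBg => ?_
  have hB : Bg.1 ∈ K.gramR := (List.of_mem_zip hBg).1
  unfold liftOKR at hZ
  have hb := List.all_eq_true.1 hZ Bg.1 hB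
  simp only [Bool.and_eq_true, decide_eq_true_eq] at hb
  obtain ⟨hDpos, hlift⟩ := hb
  have hD : ((blockDen Bg.1 : ℕ) : ℚ) ≠ 0 := by exact_mod_cast hDpos.ne'
  have hrows : Bg.1.rows = (blockRowsZ Bg.1).map (liftRow ((blockDen Bg.1 : ℕ) : ℚ)) := rows_eq_lift _ _ hlift
  -- rewrite the block of record onto lifted data
  have hzip : ∀ (l : List (QPoly × List (ℤ × ℕ))), l.map (Prod.map id (liftRow ((blockDen Bg.1 : ℕ) : ℚ))) =
      l.map fun b => (b.1, liftRow ((blockDen Bg.1 : ℕ) : ℚ) b.2) :=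
    fun l => List.map_congr_left fun b _ => by cases b; rfl
  conv_rhs => rw [hrows, List.zip_map_right, List.zip_map_right, PackedNF.flatMap_map_left, hzip]
  simp only
  refine List.flatMap_congr fun a _ => ?_
  obtain ⟨p, aZ⟩ := a
  exact (rowFastFZ_eq S _ hD p aZ _ _ _ T P₂).trans rfl

/-- **THE BRIDGE: the integer-dot share IS the landed hierarchical share** (same list) — every `…OutRouteMF/PF` theorem applies. -/
theorem shareRFastMFZ_eq (S : MomSpec M) (K : SymCertR) (hZ : liftOKR K = true) (gbs : List (List QPoly)) (hm : MomTable M)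
    (κ₂ : Word → ℕ) (J L i f : ℕ) :
    shareRFastMFZ S K gbs hm κ₂ J L i f = shareRFastMF S K gbs hm κ₂ J L i f := by
  unfold shareRFastMFZ shareRFastMF
  simp only [shareRWithMFZ_eq S K hZ]

/-- **CLOSING, integer dots** (= `energyDensity_ge_of_outroutePMF0` with the share twin; one extra global fact `hZ`). -/
theorem energyDensity_ge_of_outroutePMFZ0 (Sm : MomSpec M) (K : SymCertR) (hwf : wellFormed K.expand = true)
    (hRok : K.gramR.all (gramBlockROK K.frame) = true) (oP : PackedNF.PWord → PackedNF.PHint) (hm : MomTable M)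
    (κ₂ : Word → ℕ) (J L : ℕ) (hJ : 0 < J) (hL : 0 < L) (lo hi : ℤ × ℤ) (hbox : boxLicence K.frame lo hi = true)
    (hcov : coverM Sm K (K.gramR.map genBasis) hm = true) (hZ : liftOKR K = true)
    (hfacts : OutFactsP0 lo hi oP
      (fun m => shareRFastMFZ Sm K (K.gramR.map genBasis) hm κ₂ J L (m / L) (m % L)) 0 (J * L)) :
    ((symValueR K : ℚ) : ℝ) ≤ energyDensityTT' 1 0 8 (7 / 8) := by
  have hS : (fun m => shareRFastMFZ Sm K (K.gramR.map genBasis) hm κ₂ J L (m / L) (m % L)) =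
      fun m => shareRFastMF Sm K (K.gramR.map genBasis) hm κ₂ J L (m / L) (m % L) := by
    funext m; exact shareRFastMFZ_eq Sm K hZ _ hm κ₂ J L _ _
  rw [hS] at hfacts
  exact energyDensity_ge_of_outroutePMF0 Sm K hwf hRok oP hm κ₂ J L hJ hL lo hi hbox hcov hfacts

end IntRows

end Summit.Ventures.CertifiedManyBodySolver.Theorems.SymReplay
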